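import Mathlib.Analysis.SpecialFunctions.Pow.Real

/-!
# Crux `FMClosureUnquenched` (stmt-QuantumFields-11512), line `von-mises-circles`, stub `stub_closure`:
helper 1 — the rate arithmetic of the outward bootstrap

Pure real analysis (no lattice objects).  In the finite-volume fractional-moment bootstrap of
Aizenman–Schenker–Friedrich–Hundertmark (CMP 224 (2001) 219, proof of Thm 2) transplanted to the
regularisation `k ↦ (a_k, β_k, L_k)` of the crux, step `k` comes with an input shell radius `ℓ₀ ≥ 1`, the
size parameter `Θ_k = ℓ₀ (1 + |β_k|) ≥ max(Θ, ℓ₀)` (`Θ > 1` fixed), the lattice spacing `a = a_k → 0` with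
`ℓ₀ a ≤ K₀ (1 + |log a|)`, and two bounds for the two-point moment `E = E(0,v)` at sup-distance `n = ‖v‖ ≥ ℓ₀`:
the rate-free exterior bound `E ≤ C₁ Θ_k^{c₁ - κ}` (one forward resolvent step off the input shell) and, from
the fourth collar on (`n ≥ 4(3ℓ₀+4)`), the iterated subharmonicity bound `E ≤ M b^{⌊n/(3ℓ₀+4)⌋}` with
`M b ≤ 1`, `b ≤ 1/2`, `b ≤ C_b Θ_k^{c_b - θκ}`.  `c1_closure_rate` turns these into ONE exponential bound
`E ≤ C e^{-δ a n}` with `δ, C` INDEPENDENT of `k` (valid once `a ≤ a₀`): the logarithm `|log a_k|` allowed in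
`ℓ₀ a_k` is paid for by `log Θ_k ≥ log ℓ₀ ≥ ½ |log a_k|` when `ℓ₀ > a_k^{-1/2}`, and is not needed when
`ℓ₀ ≤ a_k^{-1/2}` (then `a_k n = O(1)` on the first collars and `b ≤ 1/2` gives an `O(1)` rate per collar).
No factor `b⁻¹` is ever introduced (it is not uniform in `k`).

References: Aizenman–Schenker–Friedrich–Hundertmark, CMP 224 (2001) 219, proof of Thm 2 [AizenmanEtAl2001].
-/

namespace Summit.QuantumFields.QCD.Theorems.VonMisesCirclesC1

/-- "The logs cancel": if `ℓ₀² a > 1` (`0 < a < 1`, `1 ≤ ℓ₀ ≤ Θ`) then `½ |log a| ≤ log Θ`. [folklore] -/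
theorem c1_closure_half_abs_log_le {a Θk : ℝ} {ℓ₀ : ℕ} (ha : 0 < a) (ha1 : a < 1) (hℓ : 1 ≤ ℓ₀)
    (hΘ : (ℓ₀ : ℝ) ≤ Θk) (h : 1 < (ℓ₀ : ℝ) ^ 2 * a) : |Real.log a| / 2 ≤ Real.log Θk := by
  have hℓpos : (0 : ℝ) < ℓ₀ := by exact_mod_cast hℓ
  have hloga : Real.log a < 0 := Real.log_neg ha ha1
  have habs : |Real.log a| = -Real.log a := abs_of_neg hloga
  have h1 : 0 < Real.log ((ℓ₀ : ℝ) ^ 2 * a) := Real.log_pos h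
  rw [Real.log_mul (by positivity) ha.ne', Real.log_pow] at h1
  have h2 : Real.log ℓ₀ ≤ Real.log Θk := Real.log_le_log hℓpos hΘ
  rw [habs]
  push_cast at h1
  linarith

/-- If `ℓ₀² a ≤ 1` (`0 < a`, `1 ≤ ℓ₀`) then `ℓ₀ a ≤ 1`. [folklore] -/
theorem c1_closure_mul_le_one_of_sq {a : ℝ} {ℓ₀ : ℕ} (ha : 0 < a) (hℓ : 1 ≤ ℓ₀)
    (h : (ℓ₀ : ℝ) ^ 2 * a ≤ 1) : (ℓ₀ : ℝ) * a ≤ 1 := by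
  have hℓ1 : (1 : ℝ) ≤ ℓ₀ := by exact_mod_cast hℓ
  nlinarith [mul_nonneg (sub_nonneg.2 hℓ1) ha.le]

/-- Collar counting: if `m = ⌊n/(3ℓ₀+4)⌋ ≥ 4` (`ℓ₀ ≥ 1`) then `n ≤ 12 (m-1) ℓ₀`. [folklore] -/
theorem c1_closure_collar_count {ℓ₀ n : ℕ} (hℓ : 1 ≤ ℓ₀) (hm : 4 ≤ n / (3 * ℓ₀ + 4)) :
    (n : ℝ) ≤ 12 * ((n / (3 * ℓ₀ + 4) : ℕ) - 1 : ℝ) * ℓ₀ := by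
  set m := n / (3 * ℓ₀ + 4) with hmdef
  have hL : 0 < 3 * ℓ₀ + 4 := by omega
  have hlt : n < m * (3 * ℓ₀ + 4) + (3 * ℓ₀ + 4) := Nat.lt_div_mul_add hL
  have hlt' : (n : ℝ) < (m : ℝ) * (3 * ℓ₀ + 4) + (3 * ℓ₀ + 4) := by exact_mod_cast hlt
  have hm4 : (4 : ℝ) ≤ m := by exact_mod_cast hm
  have hℓ1 : (1 : ℝ) ≤ ℓ₀ := by exact_mod_cast hℓ
  nlinarith [mul_nonneg (sub_nonneg.2 hm4) (sub_nonneg.2 hℓ1)]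

/-- **Rate arithmetic of the outward bootstrap** (uniformity in the regularisation step).  Given `Θ > 1`,
`K₀ > 0`, `C₁, C_b ≥ 1` and a decay parameter `κ` with `c₁ < κ`, `c_b < θκ`, there are
`δ > 0`, `C ≥ 0`, `a₀ > 0` such that for every spacing `0 < a ≤ a₀`, shell radius `ℓ₀ ≥ 1`, size parameter
`Θ_k ≥ max(Θ, ℓ₀)` with `ℓ₀ a ≤ K₀(1+|log a|)`, every distance `n ≥ ℓ₀` and every quantity `E` obeying the
rate-free bound `E ≤ C₁ Θ_k^{c₁-κ}` and, when `n ≥ 4(3ℓ₀+4)`, the collar bound `E ≤ M b^{⌊n/(3ℓ₀+4)⌋}` with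
`0 ≤ b ≤ 1/2`, `b ≤ C_b Θ_k^{c_b-θκ}`, `0 ≤ M`, `M b ≤ 1`: `E ≤ C e^{-δ a n}`.
[cite: AizenmanEtAl2001, proof of Thm 2] -/
theorem c1_closure_rate : ∀ (Θ K₀ C₁ c₁ Cb cb θ κ : ℝ), 1 < Θ → 0 < K₀ → 1 ≤ C₁ → 1 ≤ Cb → c₁ < κ → cb < θ * κ → ∃ δ C a₀ : ℝ, 0 < δ ∧ 0 ≤ C ∧ 0 < a₀ ∧ ∀ (a Θk b M E : ℝ) (ℓ₀ n : ℕ), 0 < a → a ≤ a₀ → 1 ≤ ℓ₀ → Θ ≤ Θk → (ℓ₀ : ℝ) ≤ Θk → (ℓ₀ : ℝ) * a ≤ K₀ * (1 + |Real.log a|) → ℓ₀ ≤ n → E ≤ C₁ * Θk ^ (c₁ - κ) → (4 * (3 * ℓ₀ + 4) ≤ n → 0 ≤ b ∧ b ≤ 1 / 2 ∧ b ≤ Cb * Θk ^ (cb - θ * κ) ∧ 0 ≤ M ∧ M * b ≤ 1 ∧ E ≤ M * b ^ (n / (3 * ℓ₀ + 4))) → E ≤ C * Real.exp (-(δ * (a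 * n))) := by
  intro Θ K₀ C₁ c₁ Cb cb θ κ hΘ hK₀ hC₁ hCb hκ₁ hκ₂
  -- the two decay exponents
  obtain ⟨κ₁, hκ₁pos, hκ₁eq⟩ : ∃ κ₁ : ℝ, 0 < κ₁ ∧ c₁ - κ = -κ₁ := ⟨κ - c₁, by linarith, by ring⟩
  obtain ⟨κ₂, hκ₂pos, hκ₂eq⟩ : ∃ κ₂ : ℝ, 0 < κ₂ ∧ cb - θ * κ = -κ₂ := ⟨θ * κ - cb, by linarith, by ring⟩
  have hlog2 : 0 < Real.log 2 := Real.log_pos (by norm_num)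
  -- the rate
  obtain ⟨δ, hδpos, hδ1, hδ2, hδ3⟩ : ∃ δ : ℝ, 0 < δ ∧ δ ≤ Real.log 2 / 12 ∧ δ ≤ κ₁ / (56 * K₀) ∧
      δ ≤ κ₂ / (96 * K₀) :=
    ⟨min (Real.log 2 / 12) (min (κ₁ / (56 * K₀)) (κ₂ / (96 * K₀))),
      lt_min (by positivity) (lt_min (by positivity) (by positivity)), min_le_left _ _,
      (min_le_right _ _).trans (min_le_left _ _), (min_le_right _ _).trans (min_le_right _ _)⟩
  -- the threshold on the spacing
  set T : ℝ := 8 * Real.log Cb / (3 * κ₂) + 1 / 3 with hTdef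
  have hlogCb : 0 ≤ Real.log Cb := Real.log_nonneg hCb
  refine ⟨δ, C₁ * Real.exp (28 * δ * (1 + K₀)), min (1 / 2) (Real.exp (-T)), hδpos, by positivity,
    lt_min (by norm_num) (Real.exp_pos _), ?_⟩
  intro a Θk b M E ℓ₀ n ha ha₀ hℓ hΘk hℓΘ hK hℓn hE1 hE2
  -- basic facts
  have ha12 : a ≤ 1 / 2 := ha₀.trans (min_le_left _ _)
  have ha1 : a < 1 := by linarith
  have haT : a ≤ Real.exp (-T) := ha₀.trans (min_le_right _ _)
  have hΘkpos : 0 < Θk := by linarith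
  have hΘk1 : 1 ≤ Θk := by linarith
  have hlogΘk : 0 ≤ Real.log Θk := Real.log_nonneg hΘk1
  have hℓpos : (0 : ℝ) < ℓ₀ := by exact_mod_cast hℓ
  have hℓ1 : (1 : ℝ) ≤ ℓ₀ := by exact_mod_cast hℓ
  have hloga : Real.log a < 0 := Real.log_neg ha ha1
  have habs : |Real.log a| = -Real.log a := abs_of_neg hloga
  have habs0 : 0 ≤ |Real.log a| := abs_nonneg _
  have hn0 : (0 : ℝ) ≤ n := Nat.cast_nonneg n
  have hC1pos : 0 < C₁ := by linarith
  -- `|log a| ≥ T`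
  have hlogaT : T ≤ |Real.log a| := by
    rw [habs]
    have := Real.log_le_log ha haT
    rw [Real.log_exp] at this
    linarith
  -- the target written with one exponential
  have key : ∀ X : ℝ, E ≤ C₁ * Real.exp (-X) → X + 28 * δ * (1 + K₀) ≥ δ * (a * n) →
      E ≤ C₁ * Real.exp (28 * δ * (1 + K₀)) * Real.exp (-(δ * (a * n))) := by
    intro X h1 h2
    refine h1.trans ?_
    rw [mul_assoc, ← Real.exp_add]
    exact mul_le_mul_of_nonneg_left (Real.exp_le_exp.2 (by linarith)) hC1pos.le
  by_cases hn4 : 4 * (3 * ℓ₀ + 4) ≤ n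
  · -- Case B: from the fourth collar on, the iterated bound
    obtain ⟨hb0, hb12, hbΘ, hM0, hMb, hE⟩ := hE2 hn4
    set m := n / (3 * ℓ₀ + 4) with hmdef
    have hL : 0 < 3 * ℓ₀ + 4 := by omega
    have hm4 : 4 ≤ m := (Nat.le_div_iff_mul_le hL).2 hn4
    obtain ⟨m', hm'⟩ : ∃ m' : ℕ, m = m' + 1 := ⟨m - 1, by omega⟩
    have hcount : (n : ℝ) ≤ 12 * (m' : ℝ) * ℓ₀ := by
      have h := c1_closure_collar_count (n := n) hℓ hm4
      rw [← hmdef, hm'] at h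
      push_cast at h
      linarith
    have hm'0 : (0 : ℝ) ≤ m' := Nat.cast_nonneg m'
    rcases hb0.eq_or_lt with hb00 | hbpos
    · -- `b = 0`
      have hE0 : E ≤ 0 := by
        rw [← hb00, hm', zero_pow (Nat.succ_ne_zero m'), mul_zero] at hE
        exact hE
      exact hE0.trans (by positivity)
    -- `0 < b ≤ 1/2`: `E ≤ b^{m'}`, and `12 δ a ℓ₀ ≤ log (1/b)`
    have hEb : E ≤ b ^ m' := by
      refine hE.trans ?_
      rw [hm', pow_succ, ← mul_assoc, mul_comm (M * b ^ m'), ← mul_assoc, mul_comm b M, mul_comm]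
      exact mul_le_of_le_one_right (pow_nonneg hb0 _) hMb
    have hlogb2 : Real.log b ≤ -Real.log 2 := by
      have := Real.log_le_log hbpos hb12
      rwa [one_div, Real.log_inv] at this
    -- the per-collar rate: `12 δ a ℓ₀ ≤ -log b`
    have hrate : 12 * δ * (a * ℓ₀) ≤ -Real.log b := by
      by_cases hsq : (ℓ₀ : ℝ) ^ 2 * a ≤ 1
      · have h1 : (ℓ₀ : ℝ) * a ≤ 1 := c1_closure_mul_le_one_of_sq ha hℓ hsq
        have h2 : δ * ((ℓ₀ : ℝ) * a) ≤ δ * 1 := mul_le_mul_of_nonneg_left h1 hδpos.le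
        have h3 : 12 * δ * (a * ℓ₀) = 12 * (δ * ((ℓ₀ : ℝ) * a)) := by ring
        linarith
      · push Not at hsq
        have hhalf : |Real.log a| / 2 ≤ Real.log Θk := c1_closure_half_abs_log_le ha ha1 hℓ hℓΘ hsq
        -- `log b ≤ log Cb - κ₂ log Θk`
        have hbexp : b ≤ Cb * Real.exp (-(κ₂ * Real.log Θk)) := by
          refine hbΘ.trans (le_of_eq ?_)
          rw [Real.rpow_def_of_pos hΘkpos, hκ₂eq]
          ring_nf
        have hlogb : Real.log b ≤ Real.log Cb - κ₂ * Real.log Θk := by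
          have h1 := Real.log_le_log hbpos hbexp
          rw [Real.log_mul (by linarith) (Real.exp_pos _).ne', Real.log_exp] at h1
          linarith
        have h2 : 12 * δ * (a * ℓ₀) ≤ κ₂ / 8 * (1 + |Real.log a|) := by
          have h3 : 12 * δ * K₀ ≤ κ₂ / 8 := by
            rw [le_div_iff₀ (by positivity)] at hδ3
            linarith
          calc 12 * δ * (a * ℓ₀) = 12 * δ * ((ℓ₀ : ℝ) * a) := by ring
            _ ≤ 12 * δ * (K₀ * (1 + |Real.log a|)) :=
                mul_le_mul_of_nonneg_left hK (by positivity)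
            _ = 12 * δ * K₀ * (1 + |Real.log a|) := by ring
            _ ≤ κ₂ / 8 * (1 + |Real.log a|) := mul_le_mul_of_nonneg_right h3 (by positivity)
        have h4 : Real.log Cb + κ₂ / 8 ≤ 3 * κ₂ / 8 * |Real.log a| := by
          have h5 : 3 * κ₂ / 8 * T = Real.log Cb + κ₂ / 8 := by
            rw [hTdef]
            field_simp
          rw [← h5]
          exact mul_le_mul_of_nonneg_left hlogaT (by positivity)
        have h6 : κ₂ * (|Real.log a| / 2) ≤ κ₂ * Real.log Θk := mul_le_mul_of_nonneg_left hhalf hκ₂pos.le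
        linarith
    refine key (-(m' * Real.log b)) ?_ ?_
    · rw [neg_neg, Real.exp_nat_mul, Real.exp_log hbpos]
      exact hEb.trans (le_mul_of_one_le_left (pow_nonneg hb0 _) hC₁)
    · have h1 : δ * (a * n) ≤ δ * (a * (12 * m' * ℓ₀)) :=
        mul_le_mul_of_nonneg_left (mul_le_mul_of_nonneg_left hcount ha.le) hδpos.le
      have h2 : δ * (a * (12 * m' * ℓ₀)) = m' * (12 * δ * (a * ℓ₀)) := by ring
      have h3 : m' * (12 * δ * (a * ℓ₀)) ≤ m' * (-Real.log b) := mul_le_mul_of_nonneg_left hrate hm'0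
      have h4 : 0 ≤ 28 * δ * (1 + K₀) := by positivity
      have h5 : (m' : ℝ) * (-Real.log b) = -(m' * Real.log b) := by ring
      linarith
  · -- Case A: the first collars, the rate-free bound
    have hn28 : (n : ℝ) ≤ 28 * ℓ₀ := by
      have : n ≤ 28 * ℓ₀ := by omega
      exact_mod_cast this
    have hE1' : E ≤ C₁ * Real.exp (-(κ₁ * Real.log Θk)) := by
      refine hE1.trans (le_of_eq ?_)
      rw [Real.rpow_def_of_pos hΘkpos, hκ₁eq]
      ring_nf
    by_cases hsq : (ℓ₀ : ℝ) ^ 2 * a ≤ 1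
    · -- `ℓ₀ ≤ a^{-1/2}`: `a n ≤ 28`
      have h1 : (ℓ₀ : ℝ) * a ≤ 1 := c1_closure_mul_le_one_of_sq ha hℓ hsq
      have han : a * n ≤ 28 :=
        calc a * n ≤ a * (28 * ℓ₀) := mul_le_mul_of_nonneg_left hn28 ha.le
          _ = 28 * ((ℓ₀ : ℝ) * a) := by ring
          _ ≤ 28 * 1 := mul_le_mul_of_nonneg_left h1 (by norm_num)
          _ = 28 := by ring
      refine key (κ₁ * Real.log Θk) hE1' ?_
      have h2 : 0 ≤ κ₁ * Real.log Θk := by positivity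
      have h3 : δ * (a * n) ≤ δ * 28 := mul_le_mul_of_nonneg_left han hδpos.le
      have h4 : 0 ≤ δ * K₀ := by positivity
      have h5 : 28 * δ * (1 + K₀) = δ * 28 + 28 * (δ * K₀) := by ring
      linarith
    · -- `ℓ₀ > a^{-1/2}`: the logs cancel
      push Not at hsq
      have hhalf : |Real.log a| / 2 ≤ Real.log Θk := c1_closure_half_abs_log_le ha ha1 hℓ hℓΘ hsq
      refine key (κ₁ * Real.log Θk) hE1' ?_
      have h2 : a * n ≤ 28 * (K₀ * (1 + |Real.log a|)) := by
        calc a * n ≤ a * (28 * ℓ₀) := mul_le_mul_of_nonneg_left hn28 ha.le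
          _ = 28 * ((ℓ₀ : ℝ) * a) := by ring
          _ ≤ 28 * (K₀ * (1 + |Real.log a|)) := mul_le_mul_of_nonneg_left hK (by norm_num)
      have h3 : δ * (a * n) ≤ δ * (28 * (K₀ * (1 + |Real.log a|))) :=
        mul_le_mul_of_nonneg_left h2 hδpos.le
      have h4 : 28 * δ * K₀ ≤ κ₁ / 2 := by
        rw [le_div_iff₀ (by positivity)] at hδ2
        linarith
      have h5 : 28 * δ * K₀ * |Real.log a| ≤ κ₁ / 2 * |Real.log a| :=
        mul_le_mul_of_nonneg_right h4 habs0
      have h6 : κ₁ * (|Real.log a| / 2) ≤ κ₁ * Real.log Θk := mul_le_mul_of_nonneg_left hhalf hκ₁pos.le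
      have h7 : δ * (28 * (K₀ * (1 + |Real.log a|))) = 28 * (δ * K₀) + 28 * δ * K₀ * |Real.log a| := by ring
      have h8 : 28 * δ * (1 + K₀) = 28 * δ + 28 * (δ * K₀) := by ring
      have h9 : κ₁ / 2 * |Real.log a| = κ₁ * (|Real.log a| / 2) := by ring
      linarith

end Summit.QuantumFields.QCD.Theorems.VonMisesCirclesC1
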